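import Summits.QuantumFields.YangMills.Theorems.LangevinControlUVOSLegsAtWeakCouplingCSketchRetype
import HarnessLib

/-!
# Crux `OSLegsAtWeakCouplingC` (stmt-QuantumFields-16207): the typed SPLIT into three sub-cruxes, with landed glue

Support file (continuation lead c6 of line `Sketch`).  Leads c3–c5 handed the crux back `promote-stub`: once the
landed composition of line `Sketch` is read pointwise (`…SketchRetype.lean`, p138533), the crux
`OSLegsAtWeakCouplingC` (H1 femto two-point package ∧ H2 skewness ∧ H3 gap in continuous units ⟹ OS data) is
the conjunction of three engine-grade legs that no line can derive from H1–H3 — E0′ (volume-uniform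
hyperscaling), NT (large-torus non-triviality; NECESSARY, p138920) and E1 (rotation restoration; NECESSARY in
lattice form, p139098).  This file states the three legs as self-contained propositions IN THE VOCABULARY OF THE
ROUTE FILE (only `Mathlib` + `Summits.QuantumFields.Statement` constants: `wilsonMeasure`, `torusLift`,
`plaquetteObs`, `configShift`, `box`, `siteToE`, `thetaTest`, `SpeciesScheme`, …; no Theorems-side predicate;
each ≤ 3900 characters, so each is also a registrable stub of the crux skeleton), so that a planner can file
them verbatim as items, and proves the glue twice:

* `osLegsAtWeakCouplingC_of_legs`  — predicate form (registered sub-goal of the skeleton, line `Sketch` v10):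
  `(hyps ⇒ MomentBounds6) → (hyps ⇒ LowerBounds) → (H1, H3, MomentBounds6 ⇒ lattice Ward) → OSLegsAtWeakCouplingC`;
* `osLegsAtWeakCouplingC_of_subs`  — the SAME glue DEF-FREE in route vocabulary (the three hypotheses are the
  inlined statements `UVHyperscalingC`, `LargeTorusNonTrivialityC`, `LatticeWardGermC` of children.json, attached
  to the item by lead c6), ready for
  `ledger route edit route-QuantumFields-LangevinControlUV --split OSLegsAtWeakCouplingC --into children.json
   --glue-by Summit.QuantumFields.YangMills.Cruxes.OSLegsAtWeakCouplingC.Sketch.osLegsAtWeakCouplingC_of_subs`.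

The three legs:
* E0′C (`UVHyperscalingC`): H1 → H2 → H3 ⟹ for `β ≥ β₄`, on EVERY odd torus, the centred mixed moment of `n`
  single-plane plaquette fields at sites of pairwise torus sup-distance `≥ 2R+4` (`1 ≤ R`, `R·a(β) ≤ ℓ₄`,
  `4R+8 ≤ L`) is at most `(C/R⁴)ⁿ` — `uvHyperscalingC_pointwise_iff`: definitionally `MomentBounds6 G r a`;
* NTC (`LargeTorusNonTrivialityC`): H1 → H2 → H3 ⟹ k-free lower bounds `ε ≤ Q2(θv, v)` and `ε ≤ |Q3(f, g, h)|`
  for the bare smeared truncated two- / connected three-point functions of the action density at spacing `a(β)`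
  on all tori `a(β)·L ≥ Λ₅`, `β ≥ β₅`, stated with ONE quantifier block —
  `largeTorusNonTrivialityC_pointwise_iff`: equivalent to `LowerBounds G r a` (max of thresholds, min of `ε`);
* E1C (`LatticeWardGermC`): H1 → H3 → E0′ ⟹ along every scheme in units `a` with `β_k → ∞` and the bundle
  ranges, for `n ≥ 2` the centred lattice `n`-point distributions of the action density annihilate, as `k → ∞`,
  the rotation-generator derivative of every compactly supported, separated, off-diagonal test function of small
  diameter — the lattice rotation-Ward defect (`latticeWard_of_latticeWardGermC_pointwise`, via
  `latticeDist_apply`).  H2 (skewness) and NT (lower bounds) are not inputs of a Ward identity and are dropped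
  from E1C's hypotheses; E0′ (a priori bounds) is kept.

Nothing is asserted: the three statements appear only as HYPOTHESES (and as sides of `Iff`s).  The glue uses
`cruxC_iff` and `osLegsAtWeakCouplingC_retyped_latticeWard` (p138533: once E0′ and NT are in hand the crux
hypotheses are used only through `a > 0`, `a → 0`, H3).  Refs: JaffeWitten2000 §4/§6; OsterwalderSchrader1975 §2;
GlimmJaffe1987 §6.1/§19; Balaban1989LargeFieldII, MagnenRivasseauSeneor1993 (E0′/NT as UV-engine outputs);
crux `NOTES.md` (re-type menu R1).
-/

set_option autoImplicit false

open scoped SchwartzMap BigOperators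
open MeasureTheory Filter Topology
open Literature.MathematicalPhysics.QuantumFieldTheory Literature.MathematicalPhysics.QuantumLattice
open Literature.MathematicalPhysics.AQFT Literature.Probability.LatticeModels
open Summit.QuantumFields.YangMills.Theses.LangevinControlUV (OSLegsAtWeakCouplingC)
open Summit.QuantumFields.YangMills.Cruxes.OSLegsFromFemtoAndGap.DlrCollarTransfer
open Summit.QuantumFields.YangMills.Theorems.OSLegsFromFemtoAndGap (latticeDist latticeDist_apply)

namespace Summit.QuantumFields.YangMills.Cruxes.OSLegsAtWeakCouplingC.Sketch

/-! ## §1 The three legs, pointwise, against the line's predicates (bridges) -/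

section Bridges

variable {G : Type} [Group G] [TopologicalSpace G] [IsTopologicalGroup G] [CompactSpace G]
  [MeasurableSpace G] [BorelSpace G]

/-- E0′ pointwise: the route-vocabulary hyperscaling statement for `(G, r, a)` IS `MomentBounds6 G r a`
(`torusE`, `plane` unfolded). -/
theorem uvHyperscalingC_pointwise_iff (r : LatticeRep G) (a : ℝ → ℝ) :
    (∃ (C β₄ ℓ₄ : ℝ), 0 < ℓ₄ ∧ 0 ≤ C ∧ ∀ β : ℝ, β₄ ≤ β → ∀ (L n : ℕ) (q : Fin n → Fin 4 × Fin 4) (x : Fin n → (Fin 4 → ℤ)) (R : ℕ), (∀ i, (q i).1 < (q i).2) → 1 ≤ R → (R : ℝ) * a β ≤ ℓ₄ → 4 * R + 8 ≤ L → (∀ i j : Fin n, i ≠ j → ∃ k : Fin 4, (2 * (R : ℤ) + 4) ≤ |((((x i k - x j k : ℤ) : ZMod (2 * L + 1))).valMinAbs : ℤ)|) → let E : (LGConfig 4 G → ℝ) → ℝ := fun F => ∫ U, F (torusLift (2 * L + 1) U) ∂(wilsonMeasure (d := 4) (L := 2 * L + 1) r.ρ β); let Pl : Fin 4 × Fin 4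 → (Fin 4 → ℤ) → LGConfig 4 G → ℝ := fun p y U => plaquetteObs r.ρ 0 p.1 p.2 (configShift (-y) U); |E (fun U => ∏ i, (Pl (q i) (x i) U - E (Pl (q i) (x i))))| ≤ (C / (R : ℝ) ^ 4) ^ n) ↔ MomentBounds6 G r a :=
  Iff.rfl

/-- NT pointwise: the route-vocabulary large-torus lower bounds for `(G, r, a)`, stated with one quantifier
block (`v, f, g, h, ε, β₅, Λ₅` shared by the two- and the three-point clause), are EQUIVALENT to
`LowerBounds G r a` (`Q2`, `Q3`, `torusK3`, `torusE`, `dens` unfold definitionally; split: project; merge: the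
larger thresholds and the smaller `ε`). -/
theorem largeTorusNonTrivialityC_pointwise_iff (r : LatticeRep G) (a : ℝ → ℝ) :
    (∃ (v f g h : SchwartzMap (EuclideanSpace ℝ (Fin 4)) ℝ) (ε β₅ Λ₅ : ℝ), tsupport v ⊆ {y : EuclideanSpace ℝ (Fin 4) | 0 < y 0} ∧ Disjoint (tsupport f) (tsupport g) ∧ Disjoint (tsupport g) (tsupport h) ∧ Disjoint (tsupport f) (tsupport h) ∧ 0 < ε ∧ ∀ β : ℝ, β₅ ≤ β → ∀ L : ℕ, Λ₅ ≤ a β * L → let E : (LGConfig 4 G → ℝ) → ℝ := fun F => ∫ U, F (torusLift (2 * L + 1) U) ∂(wilsonMeasure (d := 4) (L := 2 * L + 1) r.ρ β); let D : (Fin 4 → ℤ) → LGConfig 4 G → ℝ := fun x U => r.curvature.F (configShift (-x) U); (ε ≤ ∑ x ∈ box 4 L, ∑ y ∈ box 4 L, thetaTest 4 v (a β • siteToE x) * v (a β • siteToE y) * (E (fun U => D x U * D y U) - E (D x) * E (D y))) ∧ (ε ≤ |∑ x ∈ box 4 L, ∑ y ∈ box 4 L, ∑ z ∈ box 4 L,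 f (a β • siteToE x) * g (a β • siteToE y) * h (a β • siteToE z) * (E (fun U => D x U * D y U * D z U) - E (D x) * E (fun U => D y U * D z U) - E (D y) * E (fun U => D x U * D z U) - E (D z) * E (fun U => D x U * D y U) + 2 * (E (D x) * E (D y) * E (D z)))|)) ↔ LowerBounds G r a := by
  constructor
  · rintro ⟨v, f, g, h, ε, β₅, Λ₅, hv, hfg, hgh, hfh, hε, H⟩
    exact ⟨⟨v, ε, β₅, Λ₅, hv, hε, fun β hβ L hL => (H β hβ L hL).1⟩,
      ⟨f, g, h, ε, β₅, Λ₅, hfg, hgh, hfh, hε, fun β hβ L hL => (H β hβ L hL).2⟩⟩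
  · rintro ⟨⟨v, ε, β₅, Λ₅, hv, hε, H⟩, ⟨f, g, h, ε', β₅', Λ₅', hfg, hgh, hfh, hε', H'⟩⟩
    refine ⟨v, f, g, h, min ε ε', max β₅ β₅', max Λ₅ Λ₅', hv, hfg, hgh, hfh, lt_min hε hε',
      fun β hβ L hL => ⟨?_, ?_⟩⟩
    · exact (min_le_left _ _).trans (H β ((le_max_left _ _).trans hβ) L ((le_max_left _ _).trans hL))
    · exact (min_le_right _ _).trans (H' β ((le_max_right _ _).trans hβ) L ((le_max_right _ _).trans hL))

/-- E1 pointwise: the route-vocabulary lattice rotation-Ward statement for `(G, r, a)` implies the `latticeDist`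
form consumed by `osLegsAtWeakCouplingC_retyped_latticeWard` (`latticeDist_apply`; `torusMoment`,
`wilsonTorusMean`, `Separated`, `SmallDiam` unfold definitionally). -/
theorem latticeWard_of_latticeWardGermC_pointwise (r : LatticeRep G) (a : ℝ → ℝ)
    (h : ∀ (sch : SpeciesScheme (YMSpecies G)), (∀ k, sch.a k = a (sch.β k)) → Filter.Tendsto sch.β Filter.atTop Filter.atTop → (∀ k, 0 ≤ sch.β k ∧ sch.a k ≤ 1 / 24 ∧ 14 ≤ sch.L k ∧ (sch.a k)⁻¹ * (sch.a k)⁻¹ ≤ sch.L k) → ∃ r₀ : ℝ, 0 < r₀ ∧ ∀ (n : ℕ), 2 ≤ n → ∀ (F D : SchwartzMap (Fin n → EuclideanSpace ℝ (Fin 4)) ℂ), IsOffDiagonal F → HasCompactSupport (F : (Fin n → EuclideanSpace ℝ (Fin 4)) → ℂ) → (∃ δ : ℝ, 0 < δ ∧ tsupport (F : (Fin n → EuclideanSpace ℝ (Fin 4)) → ℂ) ⊆ {x | ∀ i j, i ≠ j → δ ≤ dist (x i) (x j)}) → tsupport (F : (Fin n → EuclideanSpace ℝ (Fin 4)) → ℂ)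 ⊆ {x | ∀ i j, dist (x i) (x j) < r₀} → (∀ x, D x = fderiv ℝ (F : (Fin n → EuclideanSpace ℝ (Fin 4)) → ℂ) x (fun k => (x k 0) • (EuclideanSpace.single 1 1 : EuclideanSpace ℝ (Fin 4)) - (x k 1) • (EuclideanSpace.single 0 1 : EuclideanSpace ℝ (Fin 4)))) → Filter.Tendsto (fun k : ℕ => ∑ x ∈ Fintype.piFinset (fun _ : Fin n => box 4 (sch.L k)), (((∫ U, ∏ i, (r.curvature.F (configShift (-(x i)) (torusLift (2 * sch.L k + 1) U)) - ∫ V, r.curvature.F (torusLift (2 * sch.L k + 1) V) ∂(wilsonMeasure (d := 4) (L := 2 * sch.L k + 1) r.ρ (sch.β k))) ∂(wilsonMeasure (d := 4) (L := 2 * sch.L k + 1) r.ρ (sch.β k)) : ℝ) : ℂ) * D (fun i => sch.a k • siteToE (x i)))) Filter.atTop (nhds 0)) :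
    ∀ (sch : SpeciesScheme (YMSpecies G)), (∀ k, sch.a k = a (sch.β k)) → Tendsto sch.β atTop atTop →
      (∀ k, 0 ≤ sch.β k ∧ sch.a k ≤ 1 / 24 ∧ 14 ≤ sch.L k ∧ (sch.a k)⁻¹ * (sch.a k)⁻¹ ≤ sch.L k) →
        ∃ r₀ : ℝ, 0 < r₀ ∧ ∀ (n : ℕ), 2 ≤ n → ∀ (F D : 𝓢((Fin n → EuclideanSpace ℝ (Fin 4)), ℂ)),
          IsOffDiagonal F → HasCompactSupport (F : (Fin n → EuclideanSpace ℝ (Fin 4)) → ℂ) →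
          (∃ δ : ℝ, 0 < δ ∧ tsupport (F : (Fin n → EuclideanSpace ℝ (Fin 4)) → ℂ) ⊆ Separated n δ) →
          tsupport (F : (Fin n → EuclideanSpace ℝ (Fin 4)) → ℂ) ⊆ SmallDiam n r₀ →
          (∀ x, D x = fderiv ℝ (F : (Fin n → EuclideanSpace ℝ (Fin 4)) → ℂ) x
            (fun k => (x k 0) • (EuclideanSpace.single 1 1 : EuclideanSpace ℝ (Fin 4)) - (x k 1) • (EuclideanSpace.single 0 1 : EuclideanSpace ℝ (Fin 4)))) →
          Tendsto (fun k => latticeDist r.ρ (sch.β k) (sch.L k) (sch.a k) r.curvature.F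
            (wilsonTorusMean r.ρ (sch.β k) (sch.L k) r.curvature.F) n D) atTop (𝓝 0) := by
  intro sch hunits hβ hranges
  obtain ⟨r₀, hr₀, hW⟩ := h sch hunits hβ hranges
  refine ⟨r₀, hr₀, fun n hn F D hF hFc hsep hsmall hD => ?_⟩
  have hW' := hW n hn F D hF hFc hsep hsmall hD
  refine hW'.congr fun k => ?_
  rw [latticeDist_apply]
  rfl

end Bridges

/-! ## §2 The glue, predicate form (registered sub-goal of the skeleton) -/

/-- **The crux from its three legs, predicate form** (registered sub-goal `osLegsAtWeakCouplingC_of_legs` of the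
skeleton of line `Sketch`, v10).  If at every `(G, r, a)` carrying the crux hypotheses (E0′) `MomentBounds6` and
(NT) `LowerBounds` hold, and if H1, H3 and E0′ give (E1) the lattice rotation-Ward defect `→ 0` on the germ
along every scheme in units `a` with `β_k → ∞` and the bundle ranges, then `OSLegsAtWeakCouplingC`:
`cruxC_iff` + `osLegsAtWeakCouplingC_retyped_latticeWard`. -/
theorem osLegsAtWeakCouplingC_of_legs :
    (∀ (G : Type) [Group G] [TopologicalSpace G] [IsTopologicalGroup G] [CompactSpace G],
      IsCompactSimpleLieGroup G → letI : MeasurableSpace G := borel G; haveI : BorelSpace G := ⟨rfl⟩;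
      ∀ (r : LatticeRep G) (a : ℝ → ℝ), Continuous a → TwoPoint G r a → Skewness G r a → GapInUnits G r a →
        MomentBounds6 G r a) →
    (∀ (G : Type) [Group G] [TopologicalSpace G] [IsTopologicalGroup G] [CompactSpace G],
      IsCompactSimpleLieGroup G → letI : MeasurableSpace G := borel G; haveI : BorelSpace G := ⟨rfl⟩;
      ∀ (r : LatticeRep G) (a : ℝ → ℝ), Continuous a → TwoPoint G r a → Skewness G r a → GapInUnits G r a →
        LowerBounds G r a) →
    (∀ (G : Type) [Group G] [TopologicalSpace G] [IsTopologicalGroup G] [CompactSpace G],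
      IsCompactSimpleLieGroup G → letI : MeasurableSpace G := borel G; haveI : BorelSpace G := ⟨rfl⟩;
      ∀ (r : LatticeRep G) (a : ℝ → ℝ), Continuous a → TwoPoint G r a → GapInUnits G r a → MomentBounds6 G r a →
        ∀ (sch : SpeciesScheme (YMSpecies G)), (∀ k, sch.a k = a (sch.β k)) → Tendsto sch.β atTop atTop →
          (∀ k, 0 ≤ sch.β k ∧ sch.a k ≤ 1 / 24 ∧ 14 ≤ sch.L k ∧ (sch.a k)⁻¹ * (sch.a k)⁻¹ ≤ sch.L k) →
            ∃ r₀ : ℝ, 0 < r₀ ∧ ∀ (n : ℕ), 2 ≤ n → ∀ (F D : 𝓢((Fin n → EuclideanSpace ℝ (Fin 4)), ℂ)), IsOffDiagonal F →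
              HasCompactSupport (F : (Fin n → EuclideanSpace ℝ (Fin 4)) → ℂ) →
              (∃ δ : ℝ, 0 < δ ∧ tsupport (F : (Fin n → EuclideanSpace ℝ (Fin 4)) → ℂ) ⊆ Separated n δ) →
              tsupport (F : (Fin n → EuclideanSpace ℝ (Fin 4)) → ℂ) ⊆ SmallDiam n r₀ →
              (∀ x, D x = fderiv ℝ (F : (Fin n → EuclideanSpace ℝ (Fin 4)) → ℂ) x
                (fun k => (x k 0) • (EuclideanSpace.single 1 1 : EuclideanSpace ℝ (Fin 4)) - (x k 1) • (EuclideanSpace.single 0 1 : EuclideanSpace ℝ (Fin 4)))) →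
              Tendsto (fun k => latticeDist r.ρ (sch.β k) (sch.L k) (sch.a k) r.curvature.F
                (wilsonTorusMean r.ρ (sch.β k) (sch.L k) r.curvature.F) n D) atTop (𝓝 0)) →
    OSLegsAtWeakCouplingC := by
  intro hE0 hNT hE1
  rw [cruxC_iff]
  intro G _ _ _ _ hG
  letI : MeasurableSpace G := borel G
  haveI : BorelSpace G := ⟨rfl⟩
  intro r a ha h1 h2 h3
  have h4 : MomentBounds6 G r a := hE0 G hG r a ha h1 h2 h3
  exact osLegsAtWeakCouplingC_retyped_latticeWard G hG r a ha h1 h2 h3 h4 (hNT G hG r a ha h1 h2 h3)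
    (hE1 G hG r a ha h1 h3 h4)

/-! ## §3 The glue, def-free in route vocabulary: E0′C → NTC → E1C → the crux -/

/-- **The crux from its three sub-cruxes.**  If (E0′C) volume-uniform hyperscaling, (NTC) large-torus
non-triviality and (E1C) the lattice rotation-Ward defect — each stated in the route file's own vocabulary, E0′C
and NTC carrying the crux hypotheses H1–H3, E1C carrying H1, H3 and E0′ — hold, then `OSLegsAtWeakCouplingC`
(stmt-QuantumFields-16207) holds: the bridges of §1 and `osLegsAtWeakCouplingC_of_legs`.  The three hypotheses are,
verbatim, the statements of the candidate items `UVHyperscalingC`, `LargeTorusNonTrivialityC`, `LatticeWardGermC`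
(children.json, lead c6) and the three registered stubs of the skeleton `Lines/Sketch.lean` v10. -/
theorem osLegsAtWeakCouplingC_of_subs :
    (open Literature.MathematicalPhysics.QuantumLattice Literature.MathematicalPhysics.AQFT Literature.MathematicalPhysics.QuantumFieldTheory Literature.Probability.LatticeModels in ∀ (G : Type) [Group G] [TopologicalSpace G] [IsTopologicalGroup G] [CompactSpace G], IsCompactSimpleLieGroup G → letI : MeasurableSpace G := borel G; haveI : BorelSpace G := ⟨rfl⟩; ∀ (r : LatticeRep G), ∀ (a : ℝ → ℝ), Continuous a → (∃ (Γ : ℝ → ℝ) (β₀ ℓ₀ c C : ℝ), 0 < ℓ₀ ∧ 0 < c ∧ (∀ β, 0 < a β) ∧ Filter.Tendsto a Filter.atTop (nhds 0) ∧ (∀ s : ℝ, 0 < s → s ≤ ℓ₀ → 0 < Γ s ∧ Γ s ≤ 1) ∧ ∀ (L : ℕ) [NeZero L] (β : ℝ), β₀ ≤ β → (L : ℝ) * a β ≤ ℓ₀ → let P : (Fin 4 → ZMod L) → Fin 4 → Fin 4 → GaugeConfig 4 L G → ℝ := fun x i j U => (r.N : ℝ) - (r.ρ (plaquetteHolonomy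 U x i j)).trace.re; let E : (GaugeConfig 4 L G → ℝ) → ℝ := fun F => wilsonExpectation (d := 4) (L := L) r.ρ β F; let cov : (GaugeConfig 4 L G → ℝ) → (GaugeConfig 4 L G → ℝ) → ℝ := fun F F' => E (fun U => F U * F' U) - E F * E F'; let dist : (Fin 4 → ZMod L) → (Fin 4 → ZMod L) → ℝ := fun x y => Real.sqrt (∑ k : Fin 4, (((x k - y k).valMinAbs : ℤ) : ℝ) ^ 2); (∀ n : ℕ, 1 ≤ n → 8 * n ≤ L → c * Γ ((n : ℝ) * a β) ≤ (n : ℝ) ^ 8 * cov (P 0 0 1) (P (Pi.single (2 : Fin 4) ((n : ℕ) : ZMod L)) 0 1) ∧ (n : ℝ) ^ 8 * cov (P 0 0 1) (P (Pi.single (2 : Fin 4) ((n : ℕ) : ZMod L)) 0 1) ≤ C * Γ ((n : ℝ) * a β)) ∧ (∀ (x y : Fin 4 → ZMod L) (i j i' j' : Fin 4), x ≠ y → i ≠ j → i' ≠ j' → |cov (P x i j) (P y i' j')| * dist x y ^ 8 ≤ C * Γ (dist x y * a β))) → (∃ (Γ₃ : ℝ → ℝ) (β₁ ℓ₁ c₃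 : ℝ), 0 < ℓ₁ ∧ 0 < c₃ ∧ (∀ s : ℝ, 0 < s → s ≤ ℓ₁ → 0 < Γ₃ s) ∧ ∀ (L : ℕ) [NeZero L] (β : ℝ), β₁ ≤ β → (L : ℝ) * a β ≤ ℓ₁ → let P : (Fin 4 → ZMod L) → Fin 4 → Fin 4 → GaugeConfig 4 L G → ℝ := fun x i j U => (r.N : ℝ) - (r.ρ (plaquetteHolonomy U x i j)).trace.re; let E : (GaugeConfig 4 L G → ℝ) → ℝ := fun F => wilsonExpectation (d := 4) (L := L) r.ρ β F; let cov : (GaugeConfig 4 L G → ℝ) → (GaugeConfig 4 L G → ℝ) → ℝ := fun F F' => E (fun U => F U * F' U) - E F * E F'; ∀ n : ℕ, 1 ≤ n → 8 * n ≤ L → c₃ * Γ₃ ((n : ℝ) * a β) ≤ (n : ℝ) ^ 12 * |E (fun U => P 0 0 1 U * P (Pi.single (2 : Fin 4) ((n : ℕ) : ZMod L)) 0 1 U * P (Pi.single (3 : Fin 4) ((n : ℕ) : ZMod L)) 0 1 U) - E (P 0 0 1) * cov (P (Pi.single (2 : Fin 4) ((n : ℕ) : ZMod L)) 0 1) (P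 (Pi.single (3 : Fin 4) ((n : ℕ) : ZMod L)) 0 1) - E (P (Pi.single (2 : Fin 4) ((n : ℕ) : ZMod L)) 0 1) * cov (P 0 0 1) (P (Pi.single (3 : Fin 4) ((n : ℕ) : ZMod L)) 0 1) - E (P (Pi.single (3 : Fin 4) ((n : ℕ) : ZMod L)) 0 1) * cov (P 0 0 1) (P (Pi.single (2 : Fin 4) ((n : ℕ) : ZMod L)) 0 1) - E (P 0 0 1) * E (P (Pi.single (2 : Fin 4) ((n : ℕ) : ZMod L)) 0 1) * E (P (Pi.single (3 : Fin 4) ((n : ℕ) : ZMod L)) 0 1)|) → (∃ (c₁ β₂ : ℝ) (S₁ : ℝ → ℕ), 0 < c₁ ∧ ∀ A B : YMSpecies G, ∃ C : ℝ, ∀ β : ℝ, β₂ ≤ β → ∀ S n : ℕ, S₁ β ≤ S → n ≤ S → |latticeConnectedCorr r.ρ β (2 * S + 1) A.F B.F n| ≤ C * Real.exp (-(c₁ * a β * n))) → ∃ (C β₄ ℓ₄ : ℝ), 0 < ℓ₄ ∧ 0 ≤ C ∧ ∀ β : ℝ, β₄ ≤ β → ∀ (L n : ℕ) (q : Fin n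 → Fin 4 × Fin 4) (x : Fin n → (Fin 4 → ℤ)) (R : ℕ), (∀ i, (q i).1 < (q i).2) → 1 ≤ R → (R : ℝ) * a β ≤ ℓ₄ → 4 * R + 8 ≤ L → (∀ i j : Fin n, i ≠ j → ∃ k : Fin 4, (2 * (R : ℤ) + 4) ≤ |((((x i k - x j k : ℤ) : ZMod (2 * L + 1))).valMinAbs : ℤ)|) → let E : (LGConfig 4 G → ℝ) → ℝ := fun F => ∫ U, F (torusLift (2 * L + 1) U) ∂(wilsonMeasure (d := 4) (L := 2 * L + 1) r.ρ β); let Pl : Fin 4 × Fin 4 → (Fin 4 → ℤ) → LGConfig 4 G → ℝ := fun p y U => plaquetteObs r.ρ 0 p.1 p.2 (configShift (-y) U); |E (fun U => ∏ i, (Pl (q i) (x i) U - E (Pl (q i) (x i))))| ≤ (C / (R : ℝ) ^ 4) ^ n) →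
    (open Literature.MathematicalPhysics.QuantumLattice Literature.MathematicalPhysics.AQFT Literature.MathematicalPhysics.QuantumFieldTheory Literature.Probability.LatticeModels in ∀ (G : Type) [Group G] [TopologicalSpace G] [IsTopologicalGroup G] [CompactSpace G], IsCompactSimpleLieGroup G → letI : MeasurableSpace G := borel G; haveI : BorelSpace G := ⟨rfl⟩; ∀ (r : LatticeRep G), ∀ (a : ℝ → ℝ), Continuous a → (∃ (Γ : ℝ → ℝ) (β₀ ℓ₀ c C : ℝ), 0 < ℓ₀ ∧ 0 < c ∧ (∀ β, 0 < a β) ∧ Filter.Tendsto a Filter.atTop (nhds 0) ∧ (∀ s : ℝ, 0 < s → s ≤ ℓ₀ → 0 < Γ s ∧ Γ s ≤ 1) ∧ ∀ (L : ℕ) [NeZero L] (β : ℝ), β₀ ≤ β → (L : ℝ) * a β ≤ ℓ₀ → let P : (Fin 4 → ZMod L) → Fin 4 → Fin 4 → GaugeConfig 4 L G → ℝ := fun x i j U => (r.N : ℝ) - (r.ρ (plaquetteHolonomy U x i j)).trace.re; let E : (GaugeConfig 4 L G → ℝ) → ℝ := fun F => wilsonExpectation (d := 4) (L := L) r.ρ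 β F; let cov : (GaugeConfig 4 L G → ℝ) → (GaugeConfig 4 L G → ℝ) → ℝ := fun F F' => E (fun U => F U * F' U) - E F * E F'; let dist : (Fin 4 → ZMod L) → (Fin 4 → ZMod L) → ℝ := fun x y => Real.sqrt (∑ k : Fin 4, (((x k - y k).valMinAbs : ℤ) : ℝ) ^ 2); (∀ n : ℕ, 1 ≤ n → 8 * n ≤ L → c * Γ ((n : ℝ) * a β) ≤ (n : ℝ) ^ 8 * cov (P 0 0 1) (P (Pi.single (2 : Fin 4) ((n : ℕ) : ZMod L)) 0 1) ∧ (n : ℝ) ^ 8 * cov (P 0 0 1) (P (Pi.single (2 : Fin 4) ((n : ℕ) : ZMod L)) 0 1) ≤ C * Γ ((n : ℝ) * a β)) ∧ (∀ (x y : Fin 4 → ZMod L) (i j i' j' : Fin 4), x ≠ y → i ≠ j → i' ≠ j' → |cov (P x i j) (P y i' j')| * dist x y ^ 8 ≤ C * Γ (dist x y * a β))) → (∃ (Γ₃ : ℝ → ℝ) (β₁ ℓ₁ c₃ : ℝ), 0 < ℓ₁ ∧ 0 < c₃ ∧ (∀ s : ℝ, 0 < s → s ≤ ℓ₁ → 0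 < Γ₃ s) ∧ ∀ (L : ℕ) [NeZero L] (β : ℝ), β₁ ≤ β → (L : ℝ) * a β ≤ ℓ₁ → let P : (Fin 4 → ZMod L) → Fin 4 → Fin 4 → GaugeConfig 4 L G → ℝ := fun x i j U => (r.N : ℝ) - (r.ρ (plaquetteHolonomy U x i j)).trace.re; let E : (GaugeConfig 4 L G → ℝ) → ℝ := fun F => wilsonExpectation (d := 4) (L := L) r.ρ β F; let cov : (GaugeConfig 4 L G → ℝ) → (GaugeConfig 4 L G → ℝ) → ℝ := fun F F' => E (fun U => F U * F' U) - E F * E F'; ∀ n : ℕ, 1 ≤ n → 8 * n ≤ L → c₃ * Γ₃ ((n : ℝ) * a β) ≤ (n : ℝ) ^ 12 * |E (fun U => P 0 0 1 U * P (Pi.single (2 : Fin 4) ((n : ℕ) : ZMod L)) 0 1 U * P (Pi.single (3 : Fin 4) ((n : ℕ) : ZMod L)) 0 1 U) - E (P 0 0 1) * cov (P (Pi.single (2 : Fin 4) ((n : ℕ) : ZMod L)) 0 1) (P (Pi.single (3 : Fin 4) ((n : ℕ) : ZMod L)) 0 1) - E (P (Pi.single (2 : Fin 4) ((n : ℕ)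 : ZMod L)) 0 1) * cov (P 0 0 1) (P (Pi.single (3 : Fin 4) ((n : ℕ) : ZMod L)) 0 1) - E (P (Pi.single (3 : Fin 4) ((n : ℕ) : ZMod L)) 0 1) * cov (P 0 0 1) (P (Pi.single (2 : Fin 4) ((n : ℕ) : ZMod L)) 0 1) - E (P 0 0 1) * E (P (Pi.single (2 : Fin 4) ((n : ℕ) : ZMod L)) 0 1) * E (P (Pi.single (3 : Fin 4) ((n : ℕ) : ZMod L)) 0 1)|) → (∃ (c₁ β₂ : ℝ) (S₁ : ℝ → ℕ), 0 < c₁ ∧ ∀ A B : YMSpecies G, ∃ C : ℝ, ∀ β : ℝ, β₂ ≤ β → ∀ S n : ℕ, S₁ β ≤ S → n ≤ S → |latticeConnectedCorr r.ρ β (2 * S + 1) A.F B.F n| ≤ C * Real.exp (-(c₁ * a β * n))) → ∃ (v f g h : SchwartzMap (EuclideanSpace ℝ (Fin 4)) ℝ) (ε β₅ Λ₅ : ℝ), tsupport v ⊆ {y : EuclideanSpace ℝ (Fin 4) | 0 < y 0} ∧ Disjoint (tsupport f) (tsupport g) ∧ Disjoint (tsupport g) (tsupport h) ∧ Disjoint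 (tsupport f) (tsupport h) ∧ 0 < ε ∧ ∀ β : ℝ, β₅ ≤ β → ∀ L : ℕ, Λ₅ ≤ a β * L → let E : (LGConfig 4 G → ℝ) → ℝ := fun F => ∫ U, F (torusLift (2 * L + 1) U) ∂(wilsonMeasure (d := 4) (L := 2 * L + 1) r.ρ β); let D : (Fin 4 → ℤ) → LGConfig 4 G → ℝ := fun x U => r.curvature.F (configShift (-x) U); (ε ≤ ∑ x ∈ box 4 L, ∑ y ∈ box 4 L, thetaTest 4 v (a β • siteToE x) * v (a β • siteToE y) * (E (fun U => D x U * D y U) - E (D x) * E (D y))) ∧ (ε ≤ |∑ x ∈ box 4 L, ∑ y ∈ box 4 L, ∑ z ∈ box 4 L, f (a β • siteToE x) * g (a β • siteToE y) * h (a β • siteToE z) * (E (fun U => D x U * D y U * D z U) - E (D x) * E (fun U => D y U * D z U) - E (D y) * E (fun U => D x U * D z U) - E (D z) * E (fun U => D x U * D y U) + 2 * (E (D x) * E (D y) * E (D z)))|)) →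
    (open Literature.MathematicalPhysics.QuantumLattice Literature.MathematicalPhysics.AQFT Literature.MathematicalPhysics.QuantumFieldTheory Literature.Probability.LatticeModels in ∀ (G : Type) [Group G] [TopologicalSpace G] [IsTopologicalGroup G] [CompactSpace G], IsCompactSimpleLieGroup G → letI : MeasurableSpace G := borel G; haveI : BorelSpace G := ⟨rfl⟩; ∀ (r : LatticeRep G), ∀ (a : ℝ → ℝ), Continuous a → (∃ (Γ : ℝ → ℝ) (β₀ ℓ₀ c C : ℝ), 0 < ℓ₀ ∧ 0 < c ∧ (∀ β, 0 < a β) ∧ Filter.Tendsto a Filter.atTop (nhds 0) ∧ (∀ s : ℝ, 0 < s → s ≤ ℓ₀ → 0 < Γ s ∧ Γ s ≤ 1) ∧ ∀ (L : ℕ) [NeZero L] (β : ℝ), β₀ ≤ β → (L : ℝ) * a β ≤ ℓ₀ → let P : (Fin 4 → ZMod L) → Fin 4 → Fin 4 → GaugeConfig 4 L G → ℝ := fun x i j U => (r.N : ℝ) - (r.ρ (plaquetteHolonomy U x i j)).trace.re; let E : (GaugeConfig 4 L G → ℝ) → ℝ := fun F => wilsonExpectation (d := 4) (L := L) r.ρ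 β F; let cov : (GaugeConfig 4 L G → ℝ) → (GaugeConfig 4 L G → ℝ) → ℝ := fun F F' => E (fun U => F U * F' U) - E F * E F'; let dist : (Fin 4 → ZMod L) → (Fin 4 → ZMod L) → ℝ := fun x y => Real.sqrt (∑ k : Fin 4, (((x k - y k).valMinAbs : ℤ) : ℝ) ^ 2); (∀ n : ℕ, 1 ≤ n → 8 * n ≤ L → c * Γ ((n : ℝ) * a β) ≤ (n : ℝ) ^ 8 * cov (P 0 0 1) (P (Pi.single (2 : Fin 4) ((n : ℕ) : ZMod L)) 0 1) ∧ (n : ℝ) ^ 8 * cov (P 0 0 1) (P (Pi.single (2 : Fin 4) ((n : ℕ) : ZMod L)) 0 1) ≤ C * Γ ((n : ℝ) * a β)) ∧ (∀ (x y : Fin 4 → ZMod L) (i j i' j' : Fin 4), x ≠ y → i ≠ j → i' ≠ j' → |cov (P x i j) (P y i' j')| * dist x y ^ 8 ≤ C * Γ (dist x y * a β))) → (∃ (c₁ β₂ : ℝ) (S₁ : ℝ → ℕ), 0 < c₁ ∧ ∀ A B : YMSpecies G, ∃ C : ℝ, ∀ β : ℝ, β₂ ≤ β → ∀ S n : ℕ,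 S₁ β ≤ S → n ≤ S → |latticeConnectedCorr r.ρ β (2 * S + 1) A.F B.F n| ≤ C * Real.exp (-(c₁ * a β * n))) → (∃ (C β₄ ℓ₄ : ℝ), 0 < ℓ₄ ∧ 0 ≤ C ∧ ∀ β : ℝ, β₄ ≤ β → ∀ (L n : ℕ) (q : Fin n → Fin 4 × Fin 4) (x : Fin n → (Fin 4 → ℤ)) (R : ℕ), (∀ i, (q i).1 < (q i).2) → 1 ≤ R → (R : ℝ) * a β ≤ ℓ₄ → 4 * R + 8 ≤ L → (∀ i j : Fin n, i ≠ j → ∃ k : Fin 4, (2 * (R : ℤ) + 4) ≤ |((((x i k - x j k : ℤ) : ZMod (2 * L + 1))).valMinAbs : ℤ)|) → let E : (LGConfig 4 G → ℝ) → ℝ := fun F => ∫ U, F (torusLift (2 * L + 1) U) ∂(wilsonMeasure (d := 4) (L := 2 * L + 1) r.ρ β); let Pl : Fin 4 × Fin 4 → (Fin 4 → ℤ) → LGConfig 4 G → ℝ := fun p y U => plaquetteObs r.ρ 0 p.1 p.2 (configShift (-y) U); |E (fun U => ∏ i, (Pl (q i) (x i) U - E (Pl (q i) (x i))))| ≤ (C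 / (R : ℝ) ^ 4) ^ n) → ∀ (sch : SpeciesScheme (YMSpecies G)), (∀ k, sch.a k = a (sch.β k)) → Filter.Tendsto sch.β Filter.atTop Filter.atTop → (∀ k, 0 ≤ sch.β k ∧ sch.a k ≤ 1 / 24 ∧ 14 ≤ sch.L k ∧ (sch.a k)⁻¹ * (sch.a k)⁻¹ ≤ sch.L k) → ∃ r₀ : ℝ, 0 < r₀ ∧ ∀ (n : ℕ), 2 ≤ n → ∀ (F D : SchwartzMap (Fin n → EuclideanSpace ℝ (Fin 4)) ℂ), IsOffDiagonal F → HasCompactSupport (F : (Fin n → EuclideanSpace ℝ (Fin 4)) → ℂ) → (∃ δ : ℝ, 0 < δ ∧ tsupport (F : (Fin n → EuclideanSpace ℝ (Fin 4)) → ℂ) ⊆ {x | ∀ i j, i ≠ j → δ ≤ dist (x i) (x j)}) → tsupport (F : (Fin n → EuclideanSpace ℝ (Fin 4)) → ℂ) ⊆ {x | ∀ i j, dist (x i) (x j) < r₀} → (∀ x, D x = fderiv ℝ (F : (Fin n → EuclideanSpace ℝ (Fin 4)) → ℂ) x (fun k => (x k 0) • (EuclideanSpace.single 1 1 : EuclideanSpace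 ℝ (Fin 4)) - (x k 1) • (EuclideanSpace.single 0 1 : EuclideanSpace ℝ (Fin 4)))) → Filter.Tendsto (fun k : ℕ => ∑ x ∈ Fintype.piFinset (fun _ : Fin n => box 4 (sch.L k)), (((∫ U, ∏ i, (r.curvature.F (configShift (-(x i)) (torusLift (2 * sch.L k + 1) U)) - ∫ V, r.curvature.F (torusLift (2 * sch.L k + 1) V) ∂(wilsonMeasure (d := 4) (L := 2 * sch.L k + 1) r.ρ (sch.β k))) ∂(wilsonMeasure (d := 4) (L := 2 * sch.L k + 1) r.ρ (sch.β k)) : ℝ) : ℂ) * D (fun i => sch.a k • siteToE (x i)))) Filter.atTop (nhds 0)) →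
    OSLegsAtWeakCouplingC := by
  intro hE0 hNT hE1
  refine osLegsAtWeakCouplingC_of_legs ?_ ?_ ?_
  · intro G _ _ _ _ hG
    letI : MeasurableSpace G := borel G
    haveI : BorelSpace G := ⟨rfl⟩
    intro r a ha h1 h2 h3
    exact (uvHyperscalingC_pointwise_iff r a).1 (hE0 G hG r a ha h1 h2 h3)
  · intro G _ _ _ _ hG
    letI : MeasurableSpace G := borel G
    haveI : BorelSpace G := ⟨rfl⟩
    intro r a ha h1 h2 h3
    exact (largeTorusNonTrivialityC_pointwise_iff r a).1 (hNT G hG r a ha h1 h2 h3)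
  · intro G _ _ _ _ hG
    letI : MeasurableSpace G := borel G
    haveI : BorelSpace G := ⟨rfl⟩
    intro r a ha h1 h3 h4
    exact latticeWard_of_latticeWardGermC_pointwise r a
      (hE1 G hG r a ha h1 h3 ((uvHyperscalingC_pointwise_iff r a).2 h4))

end Summit.QuantumFields.YangMills.Cruxes.OSLegsAtWeakCouplingC.Sketch
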